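import Summits.BirchSwinnertonDyer.BirchSwinnertonDyer.Theorems.SchneiderFreeAdditiveX3LeafOfOggSaito
import Summits.BirchSwinnertonDyer.BirchSwinnertonDyer.Theorems.SchneiderFreeAdditiveX3UpperWingPotMult
import Summits.BirchSwinnertonDyer.BirchSwinnertonDyer.Theorems.SchneiderFreeAdditiveX3AnticycControlAdditiveKF
import HarnessLib

/-!
# Route `SchneiderFreeAdditiveX3` (rung K1 door) with its SECOND WING: the FULL rank-one residue of X3♯
# (`MissingPPartAt`, both halves of BSD_p) on B6 ∩ X3 ∩ sst-twist from the door's and the wing's typed inputs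
# — ONE kernel-checked statement (no Schneider, no `p`-adic height)

Cell `bsd-schneider-ideate`, seat `bsd-schneider-door-c5` (prover, generation 8). Memo
`memos/ROUTE-P2-upper-v1-g13.md` U4: «With both wings, the cell's 7 101 pairs carry the full rank-one residue of
X3♯ (`MissingPPartAt`) modulo {KY 3.5.1 PRE, CH18 untyped, TwistUnit, tree} on (G-ord, e = 2) and modulo
{r2⁼ NONE, TwistUnit, tree} on (M) — NO Schneider, NO height.» This file is that sentence as a theorem, with
every input an explicit binder:

* DOOR (lower half `ord_p #Ш_an ≤ ord_p #Ш`): `PrintedFacts` (13 published facts by name), `ControlFacts`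
  (Poitou–Tate / Brink; conjunct 1 is all the lower half uses, all four feed the control EQUALITY the wing
  needs — item 19548 `AnticycControlAdditiveKF`, CLOSED, `anticycControlAdditiveKF_proof`), the crux r2
  `PotMultBranchIMC` (cell (M); NONE in print), and on (G-ord, `e = 2`) the three cite-only facts of the
  rebased road, `hKY` (Keller–Yin Thm. 3.5.1, typed PREPRINT claim) and `hCH` (CH18 frame + value at `𝔭′`,
  untyped print) — `additiveX3RankOneLower_of_facts_of_KY_OPEN_of_CH` (sliver-free, good-member-free).
* WING (upper half `ord_p #Ш ≤ ord_p #Ш_an`): the co-sockets at Keller–Yin-normalised curves of each cell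
  (`hCoG` = candidate `GordTwoBranchCoIMC`, the Kolyvagin half of the same KY input + CH; `hCoM` = candidate
  `PotMultBranchCoIMC`, NONE in print) and a twist-unit member on the cell (`hTU` = candidate `TwistUnitX3`,
  Vatsal/Kriz–Li type) — `Upper.missingUpperBoundAt_gordTwo/potMult_of_coIMC_of_control_of_twistUnitMember`.

`missingPPartAt_sstTwist_of_door_of_wing`: all of the above ⟹ `∀ (W, p)` on the cell (`r_an = 1`, `p` odd,
`ClassX3`, `SubSemistableTwist`), `MissingPPartAt W p` (`ord_p #Ш(E)_an = ord_p #Ш(E)`). HONEST FRAMING: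
CONDITIONAL on every displayed hypothesis — two of them (r2 and `hCoM`) have NO print, two (`hKY`, `hCoG`'s
content) rest on a PREPRINT, `hCH` is untyped print, `hTU` is a certificate per pair / open class-wide; no
item is closed, no rung leaf for the wing is registered, and BSD is NOT advanced beyond this typed reduction.

References: [JetchevSkinnerWan2017] §7.4.1; [KellerYin2024b] arXiv:2410.23241 Thm. 3.5.1; [CastellaHsieh2018]
Thm. 5.7, Lemma 5.4; [Miller2011LMS] Def. 1.1; [GrossZagier1986] I.(6.3), (7.3); [Vatsal1999] Thm. 0.3.
-/

noncomputable section

open scoped Classical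

open Field NumberField IsDedekindDomain WeierstrassCurve PowerSeries
open Literature.NumberTheory.EllipticCurves Literature.NumberTheory.EllipticCurves.GreenbergSelmer
open Literature.NumberTheory.GaloisRepresentations
open Literature.NumberTheory.GaloisCohomology
open Literature.NumberTheory.EllipticCurves.ModularForms
  Literature.NumberTheory.EllipticCurves.CaiShuTian2014
  Literature.NumberTheory.EllipticCurves.KellerYin2024
  Literature.NumberTheory.EllipticCurves.Rank1Residual
  Literature.NumberTheory.EllipticCurves.Rank1Residual.Typed
  Summit.BirchSwinnertonDyer.Rank1Residual
  Summit.BirchSwinnertonDyer.Rank1Residual.X11b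
  Summit.BirchSwinnertonDyer.Rank1Residual.X11b.AcSelmer
  Summit.BirchSwinnertonDyer.Rank1Residual.X11b.Halves
  Summit.BirchSwinnertonDyer.BirchSwinnertonDyer.Theorems.SchneiderFree
  Summit.BirchSwinnertonDyer.BirchSwinnertonDyer.Theorems.SchneiderFreeControlAtoms

set_option linter.dupNamespace false
set_option autoImplicit false

namespace Summit.BirchSwinnertonDyer.BirchSwinnertonDyer.Theorems.SchneiderFreeAdditiveX3

open Summit.BirchSwinnertonDyer.BirchSwinnertonDyer.Theses.SchneiderFreeAdditiveX3

/-- **FULL BSD_p residue (both halves, `MissingPPartAt`) on B6 ∩ X3 ∩ sst-twist in analytic rank one, from the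
door's inputs (lower half) and the second wing's inputs (upper half) — one statement, kernel-checked glue.**
DOOR: `PrintedFacts`, `ControlFacts`, `PotMultBranchIMC` (r2, (M), NONE), Gross 2004 / Gross 1991 / CST Thm. 1.1
(cite-only), `hKY` (KY 3.5.1, PRE), `hCH` (CH18 at `𝔭′`, untyped). WING: `hCoG` (co-socket at KY-normalised
(G-ord, `e = 2`) curves), `hCoM` (the same on (M); NONE), `hTU` (a twist-unit member on the cell). The control
EQUALITY the wing consumes is the CLOSED item `AnticycControlAdditiveKF` fed `ControlFacts` + Kolyvagin; the
printed facts the wing consumes (GZ I.(6.3), Kolyvagin, GZK, modularity ×2, Cassels, GZ I.(7.3), Heegner points)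
are conjuncts of `PrintedFacts`. CONDITIONAL on every displayed hypothesis; closes no item; BSD NOT advanced.
[cite: JetchevSkinnerWan2017, §7.4.1 (arXiv:1512.06894 p. 30)]
[cite: KellerYin2024b, Thm. 3.5.1 (arXiv:2410.23241 p. 20) (preprint; hypotheses hKY/hCoG)]
[cite: CastellaHsieh2018, Thm. 5.7 and Lemma 5.4 (arXiv:1505.08165 pp. 17–19) (shape of hCH; untyped)]
[cite: Miller2011LMS, Def. 1.1] [cite: Vatsal1999, Thm. 0.3 (shape of hTU)] -/
theorem missingPPartAt_sstTwist_of_door_of_wing (hF : PrintedFacts) (hCF : ControlFacts)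
    (h2 : PotMultBranchIMC)
    (hG : Gross2004.rankinLSeries_eq_mul_quadraticTwist)
    (hRat : phi_heegnerPointOfConductor_mem_ringClassField)
    (hCST : thm11_ringClassChar)
    (hKY : thm351_imc_isTorsion_mu_zero_charIdeal_eq_OPEN)
    (hCH : ∀ (p : ℕ) [Fact p.Prime] (W' : WeierstrassCurve ℚ) [W'.IsElliptic] [W'.IsGloballyMinimal]
      [NeZero (W'.conductorNorm ℤ)] (D C₂ : VariableChange ℚ) [(D • W').IsCharNeTwoNF]
      [(C₂ • (D • W').quadraticTwist ((-1 : ℚ) ^ (p / 2) * p)).IsElliptic]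
      [(C₂ • (D • W').quadraticTwist ((-1 : ℚ) ^ (p / 2) * p)).IsGloballyMinimal]
      (N : ℕ) [NeZero N] (K : Type) [Field K] [NumberField K]
      (Dt : ModularParametrizationData (C₂ • (D • W').quadraticTwist ((-1 : ℚ) ^ (p / 2) * p)) N)
      (H : HeegnerDatum N (NumberField.discr K)) (ι : K →+* ℂ)
      (P : ((C₂ • (D • W').quadraticTwist ((-1 : ℚ) ^ (p / 2) * p)).baseChange K).toAffine.Point),
      (C₂ • (D • W').quadraticTwist ((-1 : ℚ) ^ (p / 2) * p)).analyticRank = 1 →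
      Additive.N10.Locus (C₂ • (D • W').quadraticTwist ((-1 : ℚ) ^ (p / 2) * p)) p →
      (C₂ • (D • W').quadraticTwist ((-1 : ℚ) ^ (p / 2) * p)).conductorNorm ℤ = N →
      IsImaginaryQuadratic K → Odd (NumberField.discr K) → ¬ p ∣ Units.torsionOrder K →
      SatisfiesHeegnerHypothesis N K →
      ((C₂ • (D • W').quadraticTwist ((-1 : ℚ) ^ (p / 2) * p)).quadraticTwist
        (NumberField.discr K : ℚ)).entireLFunction 1 ≠ 0 →
      WeierstrassCurve.Affine.Point.map ι.toRatAlgHom P = heegnerPointComplex Dt H →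
      ¬ IsOfFinAddOrder P → p ≠ 2 → GoodOrd W' p → NumberField.discr K ≠ -3 →
      ∀ (κ : ZpExtension K p), κ.IsAnticyclotomic →
      ∀ (γ : Field.absoluteGaloisGroup K) [Fact (κ.IsTopGenerator γ)]
        (𝔭 : HeightOneSpectrum (𝓞 K)) (h𝔭 : ((p : ℕ) : 𝓞 K) ∈ 𝔭.asIdeal)
        (he : 𝔭.asIdeal.ramificationIdx (𝓞 ℚ) = 1) (hf : 𝔭.asIdeal.inertiaDeg (𝓞 ℚ) = 1),
      ∀ [NumberField (ringClassField K ι p)]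
        (Dt' : ModularParametrizationData W' (W'.conductorNorm ℤ)),
      ∀ (𝔭' : HeightOneSpectrum (𝓞 K)) (h𝔭' : ((p : ℕ) : 𝓞 K) ∈ 𝔭'.asIdeal)
        (he' : 𝔭'.asIdeal.ramificationIdx (𝓞 ℚ) = 1) (hf' : 𝔭'.asIdeal.inertiaDeg (𝓞 ℚ) = 1),
      𝔭 ≠ 𝔭' → ∀ (ι' : PadicAlgCl p ≃+* ℂ), BranchInducesPrime p ι' 𝔭' →
      ∃ (ΩK : ℂ) (Ωp : ℂ_[p]) (L : UnrSeries p) (u : unrIntegers p),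
        ΩK ≠ 0 ∧ Ωp ≠ 0 ∧ IsBDPLFunction ι' 𝔭' κ γ Dt.f ΩK Ωp L ∧ ¬ C (p : unrIntegers p) ∣ L ∧
        ∀ (y : (W'.baseChange (ringClassField K ι p : Type)).toAffine.Point),
          WeierstrassCurve.Affine.Point.map (ringClassField K ι p).subtype.toRatAlgHom y =
            heegnerPointComplexOfConductor Dt' (NumberField.discr K) H.β p →
          ∀ (θ : ringClassField K ι p)
            (hθ2 : θ ^ 2 = algebraMap ℚ (ringClassField K ι p) ((-1 : ℚ) ^ (p / 2) * p))
            (hθ : θ ≠ 0) (s : ringClassGal ι p → ℤˣ),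
          (∀ σ : ringClassGal ι p, σ.1 θ = ((s σ : ℤ) : ringClassField K ι p) * θ) →
          ∀ Q : ((C₂ • (D • W').quadraticTwist ((-1 : ℚ) ^ (p / 2) * p)).baseChange K).toAffine.Point,
          Affine.Point.map (algebraMap K (ringClassField K ι p)).toRatAlgHom Q =
            VariableChange.pointEquivBaseChange ((D • W').quadraticTwist ((-1 : ℚ) ^ (p / 2) * p)) C₂
              (ringClassField K ι p)
              ((VariableChange.pointEquiv (((D • W').quadraticTwist
                  ((-1 : ℚ) ^ (p / 2) * p)).baseChange (ringClassField K ι p : Type))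
                  (untwistAt hθ)).symm
                ((Affine.Point.congrEquiv (untwistAt_smul_eq (D • W') hθ2 hθ)).symm
                  (VariableChange.pointEquivBaseChange W' D (ringClassField K ι p)
                    (∑ τ : ringClassGal ι p,
                      (s τ : ℤ) • pointGalHom W' (ringClassField K ι p : Type) τ.1 y)))) →
          L.HasValueAt 0 (((u : unrIntegers p) : ℂ_[p]) *
            (algebraMap ℚ_[p] ℂ_[p] (logOmega (C₂ • (D • W').quadraticTwist ((-1 : ℚ) ^ (p / 2) * p))
              p (embAt K p 𝔭' h𝔭' he' hf') Q / (Dt'.c : ℚ_[p]))) ^ 2))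
    (hCoG : ∀ (W : WeierstrassCurve ℚ) [W.IsElliptic] [W.IsGloballyMinimal] (p : ℕ) [Fact p.Prime],
      p ≠ 2 → ClassX3 W p → Additive.SubGordTwo W p →
      (∃ Φ : AddSubgroup (geomTorsion W (p : ℤ)), IsRationalLine W p Φ ∧ ¬ LineDecompositionTrivialAt W p Φ) →
      Upper.AdditiveIMCUpperBDPInputManinAt W p)
    (hCoM : ∀ (W : WeierstrassCurve ℚ) [W.IsElliptic] [W.IsGloballyMinimal] (p : ℕ) [Fact p.Prime],
      p ≠ 2 → ClassX3 W p → Additive.SubM W p →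
      (∃ Φ : AddSubgroup (geomTorsion W (p : ℤ)), IsRationalLine W p Φ ∧ ¬ LineDecompositionTrivialAt W p Φ) →
      Upper.AdditiveIMCUpperBDPInputManinAt W p)
    (hTU : ∀ (W : WeierstrassCurve ℚ) [W.IsElliptic] [W.IsGloballyMinimal] (p : ℕ) [Fact p.Prime],
      W.analyticRank = 1 → p ≠ 2 → ClassX3 W p → Additive.SubSemistableTwist W p →
      ∃ (W₂ : WeierstrassCurve ℚ) (_ : W₂.IsElliptic) (_ : W₂.IsGloballyMinimal),
        IsIsogenous W₂ W ∧ Upper.TwistUnitHeegnerDataAt W₂ p) :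
    ∀ (W : WeierstrassCurve ℚ) [W.IsElliptic] [W.IsGloballyMinimal] (p : ℕ) [Fact p.Prime],
      W.analyticRank = 1 → p ≠ 2 → ClassX3 W p → Additive.SubSemistableTwist W p → MissingPPartAt W p := by
  -- the door: lower half on the whole cell
  have hLow : Summit.BirchSwinnertonDyer.BirchSwinnertonDyer.Theorems.SchneiderFree.AdditiveX3RankOneLower :=
    additiveX3RankOneLower_of_facts_of_KY_OPEN_of_CH hF hCF.1 h2 hG hRat hCST hKY hCH
  obtain ⟨hGZ, hKo, hGZK, hmod, hPar, hCas, hGZ73, -, -, hHP, -, -, -⟩ := hF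
  -- the control EQUALITY on the cell (item 19548, CLOSED) from `ControlFacts` + Kolyvagin
  have hCtl := anticycControlAdditiveKF_proof hCF.1 hCF.2.1 hCF.2.2.1 hCF.2.2.2 hKo
  intro W _ _ p _ hr hp2 hX hS
  refine missingPPartAt_of_lower_of_upper W p (hLow W p hr hp2 hX hS) ?_
  rcases hS with hM | hGo
  · exact Upper.missingUpperBoundAt_potMult_of_coIMC_of_control_of_twistUnitMember hGZ hKo hGZK hmod hPar
      hGZ73 hCas hHP hCtl hCoM (fun W _ _ p _ hr hp2 hX hM ↦ hTU W p hr hp2 hX (Or.inl hM)) W p hr hp2 hX hM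
  · exact Upper.missingUpperBoundAt_gordTwo_of_coIMC_of_control_of_twistUnitMember hGZ hKo hGZK hmod hPar
      hGZ73 hCas hHP hCtl hCoG (fun W _ _ p _ hr hp2 hX hG' ↦ hTU W p hr hp2 hX (Or.inr hG')) W p hr hp2 hX hGo

end Summit.BirchSwinnertonDyer.BirchSwinnertonDyer.Theorems.SchneiderFreeAdditiveX3

end
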